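import Mathlib
import HarnessLib
import Literature.MathematicalPhysics.StatisticalMechanics.RenormalisationMapBallABKM

/-!
# The Lipschitz constant `σ(r)` of the renormalisation map: continuity in `r` and its value at `r = 0`
# ([ABKM19] Ch. 12: the choice "`L` large, then `A` large, then `r` small" giving `σ ≤ κη`)

`RenormalisationMapBallABKM.sigmaABKM d L R A A_𝒫 r` is the explicit Lipschitz constant of `S_k` on the
`r`-ball (`RGStepABKM.isRGStepQ_abkm`).  For the fine tuning (`RGFlow.exists_tuned_of_normBound`:
`σ ≤ κη < 1`) one takes `r → 0` at fixed `(d, L, R, A, A_𝒫)`: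

* `continuous_sigmaABKM` — `r ↦ σ(r)` is continuous;
* `sigmaABKM_zero` — `σ(0) = L^dA_𝒫·abkmContrConst d L R + 2·largePartEps d L A A_𝒫 η + (64e^{3/8} + 32e^{3/8}C_{8.7}A_𝒫A^{−1} + 1)·g₂(0)`,
  `g₂(0) = κ₀^{L^d}·(2κ₀ max(1,A_𝒫))^{c(d)L^d}2^{c(d)L^d}·A^{−(η−1)}`, `κ₀ = 1 + e^{1/4}` — the block-part
  contraction constant of `C_k` (Lemma 10.1) plus terms that vanish as `A → ∞`;
* `exists_sigmaABKM_lt` — for every `δ > 0` there is `r₀ > 0` with `σ(r) < σ(0) + δ` for `|r| < r₀`.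

Everything is proved; no named fact.

## References
* S. Adams, S. Buchholz, R. Kotecký, S. Müller, arXiv:1910.13564, Theorem 6.8, Lemma 10.1, Ch. 12 (12.4),
  proof of Theorem 12.1 (choice of the parameters) [AdamsBuchholzKoteckyMuller2019].
-/

noncomputable section

namespace Literature.MathematicalPhysics.StatisticalMechanics.GradientRG

open scoped BigOperators Classical

/-- **`r ↦ σ(r)` is continuous.** [cite: AdamsBuchholzKoteckyMuller2019, Ch. 12 (12.4)] -/
theorem continuous_sigmaABKM (d L R : ℕ) (A A𝒫 : ℝ) : Continuous fun r : ℝ => sigmaABKM d L R A A𝒫 r := by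
  unfold sigmaABKM omegaABKM kappaABKM vABKM
  fun_prop

set_option maxHeartbeats 800000 in
/-- **`σ(0)`** (module docstring): every term carrying `b = r`, `C = r`, `v_r` or `ω(r)` vanishes at `r = 0`.
[cite: AdamsBuchholzKoteckyMuller2019, Ch. 12 (12.4)] -/
theorem sigmaABKM_zero (d L R : ℕ) (A A𝒫 : ℝ) : sigmaABKM d L R A A𝒫 0 =
    ((L : ℝ) ^ d * (A𝒫 * abkmContrConst d L R) + largePartEps d L A A𝒫 (1 + 1 / ((2 * (2 ^ d + 1) + 6 : ℝ) ^ d)) + largePartEps d L A A𝒫 (1 + 1 / ((2 * (2 ^ d + 1) + 6 : ℝ) ^ d))) +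
      (64 * Real.exp (3 / 8) + 32 * Real.exp (3 / 8) * (pi2BoundConst d (((2 * R + 2 : ℕ) : ℝ) + ((d / 2 + 1 : ℕ) : ℝ)) * (A𝒫 * A⁻¹)) + 1) *
        ((1 + Real.exp (1 / 4)) ^ (L ^ d) * ((2 * (1 + Real.exp (1 / 4)) * max 1 A𝒫) ^ ((2 ^ (d + 1) + 2) ^ d * L ^ d) * (2 : ℝ) ^ ((2 ^ (d + 1) + 2) ^ d * L ^ d)) * A ^ (-((1 + 1 / ((2 * (2 ^ d + 1) + 6 : ℝ) ^ d)) - 1) : ℝ)) := by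
  unfold sigmaABKM omegaABKM kappaABKM vABKM
  ring

/-- **`σ(r) < σ(0) + δ` for `|r|` small.** [cite: AdamsBuchholzKoteckyMuller2019, Ch. 12 (proof of Theorem 12.1)] -/
theorem exists_sigmaABKM_lt (d L R : ℕ) (A A𝒫 : ℝ) {δ : ℝ} (hδ : 0 < δ) :
    ∃ r₀ : ℝ, 0 < r₀ ∧ ∀ r : ℝ, |r| < r₀ → sigmaABKM d L R A A𝒫 r < sigmaABKM d L R A A𝒫 0 + δ := by
  have hc := (continuous_sigmaABKM d L R A A𝒫).continuousAt (x := (0 : ℝ))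
  rw [Metric.continuousAt_iff] at hc
  obtain ⟨r₀, hr₀, h⟩ := hc δ hδ
  refine ⟨r₀, hr₀, fun r hr => ?_⟩
  have h1 : dist r 0 < r₀ := by rwa [Real.dist_eq, sub_zero]
  have h2 := h h1
  rw [Real.dist_eq] at h2
  linarith [(abs_sub_lt_iff.1 h2).1]

end Literature.MathematicalPhysics.StatisticalMechanics.GradientRG

end
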